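import Literature.NumberTheory.EllipticCurves.Delbourgo2002.RationalDivisibility
import Literature.NumberTheory.EllipticCurves.HasseWeilGoodReductionFrobenius
import Mathlib.NumberTheory.JacobiSum.Basic
import HarnessLib

/-!
# Delbourgo 1998, Theorem 1 (ordinary case): the `p`-adic `L`-function of an elliptic curve at an
# ADDITIVE, potentially good ORDINARY prime `p ≥ 5` of defect `3, 4, 6` EXISTS and is a BOUNDED MEASURE
# (named fact; even part, E-normalised, finite-level form)

Topic `NumberTheory/EllipticCurves`, sub-directory `Delbourgo1998` (namespace = path). ONE named fact
(`thm1_exists_bounded_evenMeasure`, a `def … : Prop`, D-0014; nothing asserted, no `_holds` — size L: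
Carayol's local–global compatibility at `p ∣ N`, the modular symbols of a `p`-new weight-`2` newform
WITH nebentypus, Manin–Drinfeld / Shimura algebraicity for it, Vishik's admissibility), sibling of the
accepted `Delbourgo1998.prop4_rankZero_pow_dvd_constantCoeff` (same paper) and of
`Delbourgo2002.mainTheorem` / `Delbourgo2002.thmC_charIdeal_dvd_tameBranch` (J. Number Theory 95),
which QUANTIFY UNIVERSALLY over the analytic branch ("for every bounded `B` with the interpolation
package …") and therefore presuppose — but do not contain — the EXISTENCE of Delbourgo's analytic
element. That existence (with boundedness) is the printed THEOREM 1 of the 1998 paper; it is the one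
analytic input which the residual cell `b2b-bsdres` (sub-cell additive-p2 = X3♯(G-ord)/X4♯(G-ord),
defect `3, 4, 6`) had so far kept as a census-TYPED input
(`Summit.….Additive.CensusX43.HasOrdinaryTwistPartner` / `OrdinaryTwistPartnerAt`, and since gen 24
"tower boundedness of the forced twist partner"). Written by that sub-cell (gen 25) so that the input
becomes a NAMED, page-located published theorem.

## The printed statements (Compositio Math. 113 (1998) 123–154; held text
`paper:delbourgo1998-iwasawa-theory-elliptic-curves-at-unstable-primes`, pages as printed)

* §1.3, p. 127 (Carayol): "By a theorem of Carayol [Car] the representations `ρ_l ⊗ ε⁻¹` … correspond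
  to a cusp form `f̃ ∈ S₂(Ñ, ε⁻²)`, such that `f̃` is the newform equivalent to `f_{ε⁻¹}`. Furthermore
  the level `Ñ` of `f̃` is equal to `cond(ρ ⊗ ε⁻¹)`." LEMMA (p. 127): "Let `d = #Φ_p`. Assume that
  `p > 2`, `p ∤ d` and `Φ_p` is cyclic. Then the following conditions are equivalent: (i) The action of
  `I_p` on `T_lE` factors through `Gal(ℚ_p(μ_p)/ℚ_p)` …; (iii) There exists a character `ε` of
  `p`-power conductor such that if `f̃ ∈ S₂(Ñ, ε⁻²)` is the newform obtained from `ρ ⊗ ε⁻¹`, then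
  `Ñ_p = C_{ε²}`; (iv) `p ≡ 1 (d)`." (proof, p. 128: "`ρ_l(σ) = diag(θ(σ), θ(σ)⁻¹)` … `ε` is locally
  `θ` at `p`", `σ` a generator of `Φ_p`, so `ε` has conductor `p` and exact order `d`); p. 128:
  "`d = #Φ_p` can be read off from `ord_p Δ_E` modulo 12 (see the paper of Serre [Ser])".
* §1.4, pp. 129–130: for a newform `F ∈ S₂(M, ψ)`, `X² − A_pX + ψ(p)p = (X − α_p)(X − β_p)`, "Let
  `Ω^±` denote complex periods for `F`, so that `L(F, χ̄, 1)/Ω^{sign(χ)} ∈ ℚ̄`", the distribution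
  `μ(F, α_p)` on `ℤ_{p,J}^×` defined by `∫ χ dμ(F, α_p) := p^mJ/(α_p^m G(χ̄)) · (1 − χ̄(p)ψ(p)/α_p)
  (1 − χ(p)/α_p) · L(F, χ̄, 1)/Ω^{sign(χ)}` (`C_χ = p^mJ`, `G(χ̄) := ∑_{n=1}^{C_χ} χ̄(n)e^{2πin/C_χ}`
  the Gauss sum of `χ̄`; Gauss sums re-read from the page images, p. 129–132); "It is a result
  due to Vishik [Vis] that `μ(F, α_p)` is a `1`-admissible measure … Furthermore if `ord_p α_p = 0`
  (thus if `A_p` is a `p`-adic unit), then `μ(F, α_p)` is a bounded measure, i.e.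
  `|∫_{D(a,n)} dμ(F, α_p)|_p ≤` a fixed constant, for all `n ∈ ℕ` and `(a, pJ) = 1`."
* §1.5, p. 130, **Hypothesis (G)**: "`E` has potential good reduction at `p` and `E` possesses good
  reduction over a field `L ⊂ ℚ_p(μ_p)` where `[L : ℚ_p] = d`. By the lemma of Section 1.3, (G) is
  equivalent to the existence of a newform `f̃ = ∑ ã_n qⁿ ∈ S₂(Ñ, ε⁻²)` with `Ñ_p = C_{ε²}` and
  `f = f̃_ε`. It is an easy exercise to show that `p ∣ Ñ` if and only if `d = 3, 4` or `6`. … Let `α_p`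
  now denote a nonzero root of the polynomial `X² − ã_pX + ε⁻²(p)p`" (`= ã_p` when `d ∈ {3,4,6}`);
  the multiplier `L^{(G)}_p(X) := (1 − X/α_p)·(1 − α_pX̄/p)⁻¹` "if `d = 3, 4` or `6`".
* §1.5, p. 131, **THEOREM 1.** "Assume `E` satisfies (G). Then there exists a unique `1`-admissible
  measure `μ_E` such that `∫_{ℤ_{p,J}^×} χ dμ_E = L_p(E, χ) := p^mJ/(α_p^m G(χ̄_ε)G(ε̄)) ·
  L^{(G)}_p(χ_ε(p)) · L(E, χ⁻¹, 1)/Ω_E^{sign(χ)}`, where `χ_ε` is the primitive character associated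
  to `χε⁻¹`, `p^mJ = C_{χ_ε}` and `Ω⁺_E` (resp. `Ω⁻_E`) denotes the real (resp. imaginary) period of `E`.
  **Furthermore, if `E` has potential good ordinary reduction at `p`, `μ_E` is a bounded measure.**"
  Proof, p. 132: "Consider the distribution `μ(F, α_p)` of the previous section with `F = f̃`,
  `ψ = ε⁻²` and `M = Ñ`. Defining `μ_E` to be the twist of `μ(f̃, α_p)` by `ε⁻¹`, i.e.
  **`μ_E(x) := ε⁻¹(x)·μ(f̃, α_p)(x)`** … where `Ω^± := G(ε̄)Ω_E^{± sign(ε)}`"; p. 133: "All that remains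
  to be proven is that if `E` has potential good ordinary reduction at `p` then `ord_p α_p = 0`. As
  `L` is totally ramified over `ℚ_p` its residue field is `𝔽_p`. Write `F` for the reduction of `E`
  over `L`. … **`#F(𝔽_p) = 1 − Tr φ̃ + p = det(1 − φ̃⁻¹ | H¹_l(E)^{I_L}) = (1 − α_p)(1 − ᾱ_p)`** …
  Hence `Tr φ̃` is a `p`-adic unit and so `α_p` must be too. By Vishik's criteria [Vis],
  `μ_E = ε⁻¹μ(f̃, α_p)` is bounded." (and p. 130: "`α_pᾱ_p = p`").
* The same element, `J = 1`, is quoted in J. Number Theory 95 (2002) p. 39 (held text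
  `paper:delbourgo2002-…`): "by [De, Theorems 1, 2] there is a unique element
  `L_p^{an} ∈ ℤ_p⟦G × Δ⟧[μ_p, p⁻¹]` satisfying for all characters `χ ≠ ε` of `p`-power conductor
  `χ(L_p^{an}) = p^m/(a^m ∑_{n=1}^{p^m} χ⁻¹ε(n) exp(2πin/p^m)) × L(E, χ⁻¹, 1)/Ω_E^{sign(χ)}`,
  `m = ord_p(cond(χε⁻¹))`" — the reading ALREADY used by the accepted
  `Delbourgo2002.thmC_charIdeal_dvd_tameBranch` (module docstring there, "THE ANALYTIC SIDE").

## The transcription (scope, object, faithfulness) — WEAKER than print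

* SCOPE: `p ≥ 5`, `E = W` globally minimal, ADDITIVE at `p`, (G)-ORDINARY in the global form of the
  siblings (a `p`-th cyclotomic field `L ⊇ ℚ`, an intermediate field `F`, good reduction with unit root
  at every place `w ∣ p` of `F`; `F_w ⊆ ℚ_p(μ_p)` is Delbourgo's field `L` of Hypothesis (G), and "unit
  root" is "good ORDINARY over `L`"), and DEFECT `d = 12/gcd(12, v_pΔ_min) ∈ {3, 4, 6}` (Serre's
  formula for `#Φ_p`, as in `thmC_charIdeal_dvd_tameBranch`; the case "`p ∣ Ñ`", p. 130). `J = 1`.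
  `-- TODO(general form): Theorem 1 is printed for every J prime to p (measure on ℤ_{p,J}^×), for
  d ∈ {1, 2} as well (other multipliers L^{(G)}_p), and asserts 1-admissibility without ordinarity.`
* THE OBJECT. Print's `μ_E` is a bounded `ℂ_p`-valued measure on `ℤ_p^×`. The tree has no `p`-adic
  `L`-function for newforms with nebentypus and no complex-to-`p`-adic period pipeline, so — exactly as
  in `thmC_charIdeal_dvd_tameBranch` — the measure is transcribed through its FINITE-LEVEL values
  `μ n b` (`n ≥ 1`, `b mod pⁿ`; a distribution: `μ n b = ∑_{c ≡ b (pⁿ)} μ (n+1) c`) and its integrals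
  against EVEN Dirichlet characters, in `E`'s OWN `Ω⁺_f`-normalised modular-symbol currency
  (`[·]⁺_f = ratPlusSymbol f`, `ratTwistedSymbolSum f ψ = ∑_{b} ψ(b)[b/pⁿ]⁺_f`, `f` the newform of
  `W`): the transcribed object is the EVEN PART of `c·μ_E`, `c := ε(−1)G(ε̄)⁻¹Ω⁺_E/Ω⁺_f` the ONE
  normalising constant of the sibling (its docstring, "THE ANALYTIC SIDE"); boundedness and the
  distribution property are insensitive to `c ≠ 0` and to taking even parts. Odd characters (the
  `Ω⁻_E`-rows of print) are NOT transcribed (weaker).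
* THE ROWS (all for EVEN characters `ψ`, values in `ℂ_p`; `a := α_p` read in `ℚ_p`, see below).
  By Birch's formula (tree: `ratTwistedSymbolSum_mul_plusPeriod`, MTT §I.8 (8.6))
  `∑_{b mod p^m} ψ(b)[b/p^m]⁺_f = G(ψ)·L(E, ψ̄, 1)/Ω⁺_f` for `ψ` even primitive of conductor `p^m`, and
  `G(ψ)G(ψ̄) = p^m`, the printed rows `χ = ψ` read, after multiplication by `c`:
  (W) `ψ` even PRIMITIVE of conductor `pⁿ`, `n ≥ 2` (then `χ_ε = ψε̄` has conductor `pⁿ`,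
  `χ_ε(p) = 0`, multiplier `1`): `c·∫ψ dμ_E = a^{−n}·p⁻¹·τ(ε, ψ)·∑_{b mod pⁿ} ψ(b)[b/pⁿ]⁺_f` with the
  intrinsic Gauss sum `τ(ε, ψ) := ∑_{t mod p} ε(t)ψ(1 + t p^{n−1})` — by the Gauss–Jacobi identity
  `τ(ε,ψ)G(ψ)G(ε̄) = p·G(ψε̄)` (the sibling's flag `Del02-ThmC-GaussJacobi`, since PROVED in the tree:
  `Summit.….Additive.tameGaussSum_eq_gaussSum` / `tameGaussSum_mul_tameGaussSum_inv`); this is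
  VERBATIM the sibling's interpolation clause, now for every even primitive `ψ` (print: all `χ ≠ ε`),
  not only those of `p`-power order;
  (T0) `ψ = 1` (`χ_ε = ε̄`, `m = 1`): `c·∫1 dμ_E = a⁻¹·[0]⁺_f` — VERBATIM the sibling's `B(0)` clause;
  (T1) `ψ` even of conductor `p`, `ψ ∉ {1, ε}` (`χ_ε = ψε̄` of conductor `p`, `m = 1`, multiplier `1`;
  J. Number Theory p. 39 row): `c·∫ψ dμ_E = ε(−1)p/(a·G(ε̄)G(ψ̄ε)G(ψ))·∑_{b mod p} ψ(b)[b/p]⁺_f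
  = a⁻¹·ε(−1)·p⁻¹·J(ε, ψε̄)·∑_{b mod p} ψ(b)[b/p]⁺_f`, using `G(ε̄)G(ψ̄ε) = J(ε̄, ψ̄ε)G(ψ̄)`,
  `G(ψ)G(ψ̄) = p` and `J(ε, ψε̄)·J(ε̄, ψ̄ε) = p` (`J` the Jacobi sum, Mathlib `jacobiSum`; `ε`, `ψε̄`,
  `ψ` all non-trivial);
  (Tε) `ψ = ε` (only when `ε` is even; `χ_ε = 1`, `m = 0`, the ONLY row where the multiplier
  `L^{(G)}_p(1) = (1 − α_p⁻¹)(1 − α_p/p)⁻¹` enters; excluded in the 2002 quotation "`χ ≠ ε`", asserted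
  by the 1998 Theorem 1): `c·∫ε dμ_E = (1 − a⁻¹)(1 − a/p)⁻¹·ε(−1)·p⁻¹·∑_{b mod p} ε(b)[b/p]⁺_f`.
  CROSS-CHECK (kernel, no print needed): (W), (T0), (T1), (Tε) are EXACTLY the character sums of the
  `ε̄`-twisted Mazur–Tate–Teitelbaum measure `μ(b + pⁿℤ_p) = a^{−n}ε̄(b)Φ(b/pⁿ)` of ANY `1`-periodic
  `Φ` with `[·]⁺_f = τ_{ε̄}Φ` and `U_pΦ = aΦ(p·)` — print's `Φ = ` the `Ω`-normalised `ε(−1)`-part of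
  the modular symbol of `f̃` (p. 132 "`μ_E := ε⁻¹·μ(f̃, α_p)`"; `f = f̃ ⊗ ε`, `U_pf̃ = ã_pf̃`):
  (W) is the cell theorem `Summit.….Additive.sum_mul_twistPartnerMeasure_eq` (accepted, gen 23 of
  cc-typer-2's bridge), (T0)/(T1)/(Tε) are `Summit.….Additive.TwistPartner.twistPartnerMeasure_level_one_one`
  / `…_of_ne` / `…_self` (`Additive/TwistPartnerLevelOneTower.lean`, gen 25); and a bounded distribution
  with these rows FORCES tower boundedness of the forced twist partner of `(ε, a)`
  (`Summit.….Additive.TwistPartner.towerBounded_forced_of_measure`, `Additive/TwistPartnerForcedOfMeasure.lean`;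
  consumers `Additive/TwistPartnerForcedOfDelbourgo.lean`, `…TameBranchOfDelbourgo.lean`).
  So the fact asserts NO MORE than: "for Delbourgo's pair `(ε, α_p)` the even part of `μ_E` is a
  bounded measure" — Theorem 1, last sentence.
* THE PAIR `(ε, a)`. `ε`: a Dirichlet character mod `p` of EXACT order `d` (print: "`ε` is locally `θ`",
  `θ` faithful on the cyclic `Φ_p` of order `d`), with values in `ℚ_p` (its values are `d`-th roots of
  unity and `d ∣ p − 1`, Lemma (iv); print reads them in `ℂ_p` through the fixed embedding — choosing
  the codomain `ℚ_p` is a specialisation of notation, not of content). WHICH of the two characters of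
  order `d` (`ε` or `ε̄`; `φ(d) = 2`) carries the bounded (= `𝔭`-ordinary) twist is NOT asserted
  (print: "Without loss of generality … if not twist by `ε` instead of `ε⁻¹`", p. 130): the fact says
  `∃ ε`. `a`: print's `α_p = ã_p = a_p(f̃)`, a `p`-adic UNIT (p. 133) and — p. 133, displayed —
  a root of `X² − (Tr φ̃)X + p` where `Tr φ̃ = p + 1 − #F(𝔽_p)` is the trace of Frobenius of the
  reduction `F` of `E` over Delbourgo's field `L` (`α_pᾱ_p = p`, p. 130). In the tree:
  `a² − a_w(E_F)·a + p = 0` with `a_w = WeierstrassCurve.frobeniusTraceAt` of the base change to the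
  intermediate field `F` at the place `w ∣ p` (`k_w = 𝔽_p`: `ℚ(ζ_p)` is totally ramified at `p`; the
  reduction of the local minimal model at `w` is Delbourgo's `F`). Since `|p/a|_p < 1`, `a` is THE
  unit root — a finite datum of `E`.
* NOT in the statement: uniqueness and `1`-admissibility (boundedness is stronger where asserted);
  the odd rows; `J > 1`; the identification of `ε` among `{ε, ε̄}` (see above); any claim at `d = 2`
  (there `f̃` has level `N/p²` and the tree PROVES the analogue: `Summit.….Additive.TameBranchOfTwistBranch`).
  Flags for the referee: `Del98-Thm1-evenpart-Enormalised` (object = even part of `c·μ_E`, `c` as in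
  the sibling), `Del98-Thm1-tame-rows` ((T1)/(Tε): Birch at conductor `p`, Jacobi sums, the multiplier
  at `χ = ε` — conversions by the transcribing seat, cross-checked in the kernel as above),
  `Del98-Thm1-unitroot` (`a` pinned by p. 133), `Del98-Vishik` (print's boundedness cites [Vis] =
  Višik 1976 and Carayol 1986 [Car]). No `_holds`.

## References
* D. Delbourgo, Compositio Math. 113 (1998) 123–154: §1.3 Lemma (p. 127), §1.4 (pp. 129–130), §1.5
  Hypothesis (G), Theorem 1 (pp. 130–131), proof pp. 132–133. [Delbourgo1998]
* D. Delbourgo, J. Number Theory 95 (2002) 38–71, p. 39 (the element `L_p^{an}`). [Delbourgo2002]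
* B. Mazur, J. Tate, J. Teitelbaum, Invent. Math. 84 (1986), §I.8 (8.6), §I.10–I.14. [MazurTateTeitelbaum1986Invent]
* H. Carayol, Ann. Sci. ÉNS 19 (1986) 409–468; M. Višik, Mat. Sb. 99 (1976) 248–260.
-/

noncomputable section

open scoped Classical NumberField MatrixGroups ModularForm

open IsDedekindDomain NumberField WeierstrassCurve CongruenceSubgroup
  Literature.NumberTheory.EllipticCurves.ModularForms

namespace Literature.NumberTheory.EllipticCurves.Delbourgo1998

/-- **Delbourgo 1998, Theorem 1 (last sentence): at an ADDITIVE, potentially good ORDINARY prime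
`p ≥ 5` of defect `d ∈ {3, 4, 6}` the `p`-adic `L`-function `μ_E` EXISTS and is a BOUNDED MEASURE** —
even part, E-normalised, finite-level form (module docstring). Let `W/ℚ` be globally minimal,
`p ≥ 5` additive for `W`, (G)-ordinary in the global form (a `p`-th cyclotomic field `L ⊇ ℚ`, an
intermediate field `F`, good reduction with unit root at every `w ∣ p`), with
`12/gcd(12, v_pΔ_min) ∈ {3, 4, 6}`; `w ∣ p` a place of `F`; `f` the newform of `W`. Then THERE EXIST
a Dirichlet character `ε` mod `p` with values in `ℚ_p` of exact order `12/gcd(12, v_pΔ_min)`, a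
`p`-adic UNIT `a ∈ ℚ_p` with `a² − a_w(W_F)·a + p = 0` (the unit root of Frobenius of the good
reduction over Delbourgo's field, p. 133), and a BOUNDED family `μ n b ∈ ℂ_p` (`n ≥ 1`, `b mod pⁿ`)
satisfying the distribution relation, whose integrals against EVEN Dirichlet characters `ψ` mod `pⁿ`
(values in `ℂ_p`) are: (W) for `ψ` primitive of conductor `pⁿ`, `n ≥ 2`:
`a^{−n}·p⁻¹·(∑_{t mod p} ε(t)ψ(1 + tp^{n−1}))·∑_{b mod pⁿ} ψ(b)[b/pⁿ]⁺_f`; (T0) for `ψ = 1` (level `p`):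
`a⁻¹·[0]⁺_f`; (T1) for `ψ` of level `p`, `ψ ∉ {1, ε}`: `a⁻¹·ε(−1)·p⁻¹·J(ε, ψε̄)·∑_{b mod p} ψ(b)[b/p]⁺_f`;
(Tε) for `ψ = ε` (even): `(1 − a⁻¹)(1 − a/p)⁻¹·ε(−1)·p⁻¹·∑_{b mod p} ε(b)[b/p]⁺_f`
(`[·]⁺_f = ratPlusSymbol f`, `J` = Mathlib `jacobiSum`, `ε` transported to level `p^1` along
`ZMod (p^1) ≃ ZMod p`). Print: Theorem 1 p. 131 with `μ_E := ε⁻¹μ(f̃, α_p)` (p. 132), `α_p` a unit root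
of `X² − (p + 1 − #F(𝔽_p))X + p` (p. 133); rows converted by Birch's formula and Gauss/Jacobi-sum
identities exactly as in `Delbourgo2002.thmC_charIdeal_dvd_tameBranch` ((W), (T0) verbatim its
clauses). Weaker than print (even part; `J = 1`; `d ∈ {3,4,6}`; no uniqueness / admissibility; `∃ ε`
among the two characters of order `d`). Flags: `Del98-Thm1-evenpart-Enormalised`,
`Del98-Thm1-tame-rows`, `Del98-Thm1-unitroot`, `Del98-Vishik`. No `_holds`.
[cite: Delbourgo1998, Theorem 1 (p. 131), proof pp. 132–133, §1.3 Lemma (p. 127), §1.4 (pp. 129–130)]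
[cite: Delbourgo2002, p. 39 (the element L_p^an, rows χ ≠ ε)]
[cite: MazurTateTeitelbaum1986Invent, §I.8 (8.6), §I.10 (interpolation shape)] -/
def thm1_exists_bounded_evenMeasure : Prop :=
  ∀ (W : WeierstrassCurve ℚ) [W.IsElliptic] [W.IsGloballyMinimal] (p : ℕ) [Fact p.Prime],
    5 ≤ p →
    (¬ W.HasGoodReductionAtPrime p ∧ ¬ W.HasMultiplicativeReductionAtPrime p) →
    12 / Nat.gcd 12 (padicValInt p W.minimalDiscriminantInt) ∈ ({3, 4, 6} : Finset ℕ) →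
    ∀ (L : Type) [Field L] [NumberField L] [IsCyclotomicExtension {p} ℚ L]
      (F : IntermediateField ℚ L),
      (∀ w : HeightOneSpectrum (𝓞 F), (p : 𝓞 F) ∈ w.asIdeal →
          (W.baseChange F).HasGoodReductionAt w ∧ (W.baseChange F).HasUnitRootAt w) →
    ∀ (w : HeightOneSpectrum (𝓞 F)), (p : 𝓞 F) ∈ w.asIdeal →
    ∀ {N : ℕ} [NeZero N] (f : CuspForm (Gamma0 N) 2), IsNewformOf W f →
    ∃ (ε : DirichletCharacter ℚ_[p] p) (a : ℚ_[p]) (μ : (n : ℕ) → ZMod (p ^ n) → ℂ_[p]),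
      orderOf ε = 12 / Nat.gcd 12 (padicValInt p W.minimalDiscriminantInt) ∧
      ‖a‖ = 1 ∧
      a ^ 2 - (((W.baseChange F).frobeniusTraceAt w : ℤ) : ℚ_[p]) * a + p = 0 ∧
      -- bounded
      (∃ C : ℝ, ∀ (n : ℕ) (b : ZMod (p ^ n)), ‖μ n b‖ ≤ C) ∧
      -- a distribution on the `p`-power tower (levels `n ≥ 1`)
      (∀ (n : ℕ), 1 ≤ n → ∀ b : ZMod (p ^ n),
        ∑ c ∈ Finset.univ.filter (fun c : ZMod (p ^ (n + 1)) ↦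
            ZMod.castHom (pow_dvd_pow p n.le_succ) (ZMod (p ^ n)) c = b), μ (n + 1) c = μ n b) ∧
      -- (W) even primitive characters of conductor `pⁿ`, `n ≥ 2`
      (∀ (n : ℕ), 2 ≤ n → ∀ ψ : DirichletCharacter ℂ_[p] (p ^ n), ψ.IsPrimitive → ψ.Even →
        ∑ b : ZMod (p ^ n), ψ b * μ n b =
          algebraMap ℚ_[p] ℂ_[p] (a⁻¹ ^ n * (p : ℚ_[p])⁻¹) *
            (∑ t : ZMod p, algebraMap ℚ_[p] ℂ_[p] (ε t) *
              ψ (1 + ((t.val : ℕ) : ZMod (p ^ n)) * ((p : ZMod (p ^ n)) ^ (n - 1)))) *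
            ratTwistedSymbolSum f ψ) ∧
      -- (T0) the trivial character at level `p`
      (∑ b : ZMod (p ^ 1), (1 : DirichletCharacter ℂ_[p] (p ^ 1)) b * μ 1 b =
          algebraMap ℚ_[p] ℂ_[p] (a⁻¹ * (ratPlusSymbol f 0 : ℚ_[p]))) ∧
      -- (T1) even characters of level `p` other than `1` and `ε`
      (∀ ψ : DirichletCharacter ℂ_[p] (p ^ 1), ψ.Even → ψ ≠ 1 →
        ψ ≠ DirichletCharacter.changeLevel (dvd_pow_self p one_ne_zero)
          (ε.ringHomComp (algebraMap ℚ_[p] ℂ_[p])) →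
        ∑ b : ZMod (p ^ 1), ψ b * μ 1 b =
          algebraMap ℚ_[p] ℂ_[p] (a⁻¹ * (p : ℚ_[p])⁻¹ * ε (-1)) *
            jacobiSum
              (DirichletCharacter.changeLevel (dvd_pow_self p one_ne_zero)
                (ε.ringHomComp (algebraMap ℚ_[p] ℂ_[p])))
              (ψ * (DirichletCharacter.changeLevel (dvd_pow_self p one_ne_zero)
                (ε.ringHomComp (algebraMap ℚ_[p] ℂ_[p])))⁻¹) *
            ratTwistedSymbolSum f ψ) ∧
      -- (Tε) the character `ε` itself (when even): the row with the multiplier `L^{(G)}_p(1)`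
      ((DirichletCharacter.changeLevel (dvd_pow_self p one_ne_zero)
          (ε.ringHomComp (algebraMap ℚ_[p] ℂ_[p]))).Even →
        ∑ b : ZMod (p ^ 1),
            DirichletCharacter.changeLevel (dvd_pow_self p one_ne_zero)
              (ε.ringHomComp (algebraMap ℚ_[p] ℂ_[p])) b * μ 1 b =
          algebraMap ℚ_[p] ℂ_[p] ((1 - a⁻¹) * (1 - a / p)⁻¹ * (p : ℚ_[p])⁻¹ * ε (-1)) *
            ratTwistedSymbolSum f
              (DirichletCharacter.changeLevel (dvd_pow_self p one_ne_zero)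
                (ε.ringHomComp (algebraMap ℚ_[p] ℂ_[p]))))

end Literature.NumberTheory.EllipticCurves.Delbourgo1998

end
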